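import Summits.BirchSwinnertonDyer.Rank1Residual.O5.HeegnerLogTransportThreeStepZeroEndAnyDiscr
import Summits.BirchSwinnertonDyer.Rank1Residual.O5.HeegnerLogTransportThreeIsoCurrency
import HarnessLib
import HarnessLib.Audit.Tags

/-!
# O5 (t′) — the `htamGd'`-free KL3 END (`…_cited_s0f`) in ISO / X3E currency
# (cell `b2b-bsdres`, lane CLASS-CLOSURE, class O5; harvest seat 2 GEN 60, item E117 = o5-r2 A-O5-G24-2)

HONEST FRAMING (cell `b2b-bsdres`, run/shared/lean/b2b/bsd-rank1-residual/, verbatim in every file): the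
goal of the cell is to DELETE the COMBINATION-SHAPED residual classes of the Birch–Swinnerton-Dyer formula
for ALL analytic-rank `≤ 1` elliptic curves over `ℚ` — "full BSD formula for every rank `≤ 1` curve in
class `C`" assembled STRICTLY from published theorems — so that the rank-`≤ 1` remainder becomes exactly
the CONSTRUCTION-SHAPED classes, which are TYPED (missing-input `Prop`s), NOT attempted. This is not
"finishing BSD". Research route (class O5 = tame potentially-supersingular additive `p = 3` (t′), `9 ‖ N`):
CONDITIONAL theorems whose displayed inputs are published theorems vendored as named facts + per-pair
binders; nothing booked, no mark / label / count / tier of `RESIDUAL-MAP.md` moves, census = EVIDENCE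
(never a Literature fact); O5 stays OPEN as a class. THEOREMS ONLY — 3 corollaries, 0 `def`,
0 `@[conjecture]`, 0 Literature facts (net named-fact debt 0), no `sorry`. Unit `b2b-bsdres-harvest-2`
GEN 60, answering o5-r2 GEN 24's A-O5-G24-2 (HOME/INBOX.md l.14533: "`_cited_s0f` is YOURS … add the
3-line siblings `_cited_s0f_iso / _x3e / _x3eRev` (import part 20; pattern = part 21)").

## What this file does

Harvest-2 GEN 59's `o5_index_unit_of_ordinary_companion_cited_s0f`
(`O5/HeegnerLogTransportThreeStepZeroEndAnyDiscr.lean`, p356092: the KL3 END of record `…_cited_s0e` with the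
twist's Tamagawa binder `htamGd'` DELETED for every `d_K`; conclusion `3 ∤ [W(K) : ℤ·P]`) still displays ONE
per-pair binder that is not a finite computation: `hcong`, the trace congruence `a_ℓ(W) ≡ a_ℓ(G) (mod 3)` at
EVERY prime `ℓ ∤ 3 N_W N_G`. Exactly as o5-r2 GEN 24's part 21 does for `…_cited_s0e`, this file REPLACES
`hcong`, via part 20 (`O5/HeegnerLogTransportThreeIsoCurrency.lean`, §1), by

* `hT : TorsionIso G W 3` — `…_cited_s0f_iso` (`isCongruentModThree_of_torsionIso` = Kraus–Oesterlé 1992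
  Prop. 3 (i) ⇒ (iii), PROVED in the tree as `KrausOesterle1992.lFunction_congr_of_addEquiv_geomTorsion`);
* ONE direct X3E row `(l m u : ℚ) (hu) (h4) (h6)` — `…_cited_s0f_x3e` (`isCongruentModThree_of_hesseCertificate`;
  Fisher 2012 Thm. 13.2 (`n = 3`) PROVED in the tree, so the companion relation then rests on NO named fact);
* ONE reverse X3E row — `…_cited_s0f_x3eRev` (`isCongruentModThree_of_dualHesseCertificate`; the `X_E^-(3)`
  analogue, PROVED in the tree).

Every other binder of `…_cited_s0f` verbatim and in the same order; the displayed facts (A314 Kriz–Li 1.16,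
Poitou–Tate, local Euler–Poincaré, Yan–Zhu 4.15, Wuthrich Lemma 20, modularity, GZK) unchanged. After this
file the `…_s0f_x3e` / `…_s0f_x3eRev` ENDs display, per row: `hρ`, `hadd`, `ht3`/`htℓ`, `hunitW`/`hunitG`,
`htam`/`htamG`, `hordG`, the Heegner points `P`, `P′` non-torsion, the two `3`-descent counts + the twist's
torsion, `hQW`, `hcD`, `hc3'`, `d_K < -4`, and the X3E row `(l, m, u)` with its two polynomial identities —
no Tamagawa datum of `G_d`, no all-primes congruence. Nothing else changes; no node is touched; which END is
"of record" is the planner's / typer's word, not this file's.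

References: [KrizLi2019] Thm. 1.16, Rem. 1.17; [KrausOesterle1992] Prop. 3; [Fisher2012Hessian] Thm. 13.2
and §13; [JetchevSkinnerWan2017] §7.3.1, §7.4.1; [BarriosEtAl2025] Thm. 5.1; [YanZhu2024MainConjNonCM]
Thm. 4.15; [GrossZagier1986] Thm. I.6.3.
-/

set_option autoImplicit false

noncomputable section

open scoped Classical

open WeierstrassCurve Literature.NumberTheory.EllipticCurves
  Literature.NumberTheory.EllipticCurves.ModularForms
  Literature.NumberTheory.EllipticCurves.Rank1Residual
  Literature.NumberTheory.EllipticCurves.Rank1Residual.Typed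
open Literature.NumberTheory.EllipticCurves.Fisher2012 (hesseC4three hesseC6three hesseD3)
open Summit.BirchSwinnertonDyer.Rank1Residual.X1.CongruenceTransfer (TorsionIso)
open Summit.BirchSwinnertonDyer.Rank1Residual.X11b (embAt)
open IsDedekindDomain (HeightOneSpectrum)
open Literature.NumberTheory.GaloisCohomology (poitouTate_selmerStructure_duality)
open Literature.NumberTheory.GaloisRepresentations (localEulerPoincareCharacteristic)
open scoped NumberField

namespace Summit.BirchSwinnertonDyer.Rank1Residual.O5.HeegnerLogTransport

/-- **O5 (t′) `htamGd'`-free END (`…_cited_s0f`) in ISO CURRENCY**: the congruence binder `hcong`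
(`a_ℓ(W) ≡ a_ℓ(G) (mod 3)` at every `ℓ ∤ 3 N_W N_G`) REPLACED by the cell's currency
`hT : TorsionIso G W 3` (`∃ e : G[3] ≃+ W[3]` `Γ_ℚ`-equivariant; part 20
`isCongruentModThree_of_torsionIso` = Kraus–Oesterlé Prop. 3 (i) ⇒ (iii), proved in the tree); every
other binder of `…_cited_s0f` verbatim, same displayed facts; no Tamagawa datum of the twist `G_d`.
[cite: KrizLi2019, Thm. 1.16, Rem. 1.17 (FMS 7 (2019) e15)]
[cite: KrausOesterle1992, Prop. 3 (i) ⇒ (iii) (pp. 262–263)] -/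
theorem o5_index_unit_of_ordinary_companion_cited_s0f_iso
    (hKL : KrizLi2019.thm116_padicLogHeegner_congruence)
    (hPT : ∀ (K : Type) [Field K] [NumberField K], poitouTate_selmerStructure_duality K)
    (hEP : ∀ (K : Type) [Field K] [NumberField K] (v : HeightOneSpectrum (𝓞 K)),
      localEulerPoincareCharacteristic (v.adicCompletion K))
    (hYZ : YanZhu2026.thm415_padicValRat_bsd_rank_le_one)
    (hW20 : Wuthrich2014.lemma20_surjective_threeAdic_of_semistable)
    (hmod : exists_isNewformOf) (hGZK : rank_eq_analyticRank_of_analyticRank_le_one)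
    (W G : WeierstrassCurve ℚ) [W.IsElliptic] [W.IsGloballyMinimal] [G.IsElliptic] [G.IsGloballyMinimal]
    (hT : TorsionIso G W 3)
    (hρ : W.HasSurjectiveModNGaloisRep 3) (hadd : Addv W 3) (ht3 : NoLocalThreeTorsionAt W 3)
    (htℓ : ∀ (ℓ : ℕ) [Fact ℓ.Prime], ℓ ≠ 3 → (ℓ : ℤ) ∣ W.conductorNorm ℤ * G.conductorNorm ℤ →
      NoLocalThreeTorsionAt W ℓ)
    (hunitW : ∀ ℓ ∈ klSet W G, ℓ ≠ 3 → padicValInt 3 (nsCount W ℓ) = 0)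
    (hunitG : ∀ ℓ ∈ klSet G W, ℓ ≠ 3 → padicValInt 3 (nsCount G ℓ) = 0)
    (htam : ¬ 3 ∣ W.tamagawaProduct) (htamG : ¬ 3 ∣ G.tamagawaProduct) (hordG : GoodOrd G 3)
    (Gd : WeierstrassCurve ℚ) [Gd.IsElliptic] [Gd.IsGloballyMinimal]
    {N N' : ℕ} [NeZero N] [NeZero N'] (D : ModularParametrizationData W N)
    (D' : ModularParametrizationData G N')
    (K : Type) [Field K] [NumberField K] (hK : IsImaginaryQuadratic K)
    (hH : SatisfiesHeegnerHypothesis N K) (hH' : SatisfiesHeegnerHypothesis N' K)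
    (hKoW : kolyvagin N W K) (hKoG : kolyvagin N' G K) (hGZG : gross_zagier N' G K)
    (hd : NumberField.discr K < -4)
    (hGd : ∃ C : VariableChange ℚ, C • G.quadraticTwist (NumberField.discr K : ℚ) = Gd)
    (H : HeegnerDatum N (NumberField.discr K)) (H' : HeegnerDatum N' (NumberField.discr K))
    (ι : K →+* ℂ) (𝔭 : HeightOneSpectrum (𝓞 K)) (h𝔭 : ((3 : ℕ) : 𝓞 K) ∈ 𝔭.asIdeal)
    (he : 𝔭.asIdeal.ramificationIdx (𝓞 ℚ) = 1) (hf : 𝔭.asIdeal.inertiaDeg (𝓞 ℚ) = 1)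
    (P : (W.baseChange K).toAffine.Point) (P' : (G.baseChange K).toAffine.Point)
    (hP : WeierstrassCurve.Affine.Point.map ι.toRatAlgHom P = heegnerPointComplex D H)
    (hP' : WeierstrassCurve.Affine.Point.map ι.toRatAlgHom P' = heegnerPointComplex D' H')
    (hPinf : ¬ IsOfFinAddOrder P) (hP'inf : ¬ IsOfFinAddOrder P')
    (Wt : WeierstrassCurve ℚ) [Wt.IsElliptic]
    (hWt : ∃ C : VariableChange ℚ, C • W.quadraticTwist (NumberField.discr K : ℚ) = Wt)
    (htorst : ¬ 3 ∣ Wt.torsionOrder)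
    (hSelW : Nat.card (W.selmerGroup (3 : ℤ)) = 3 ^ W.mordellWeilRank)
    (hSelWt : Nat.card (Wt.selmerGroup (3 : ℤ)) = 3 ^ Wt.mordellWeilRank)
    (hQW : ∃ Q : (W.baseChange K).toAffine.Point, ¬ IsOfFinAddOrder Q ∧
      X11b.padicLogOrd W 3 (embAt K 3 𝔭 h𝔭 he hf) Q = 0)
    (hcD : padicValInt 3 D.maninConstant = 0) (hc3' : ¬ ((3 : ℤ) ∣ D'.maninConstant)) :
    padicValNat 3 (AddSubgroup.zmultiples P).index = 0 :=
  o5_index_unit_of_ordinary_companion_cited_s0f hKL hPT hEP hYZ hW20 hmod hGZK W G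
    (isCongruentModThree_of_torsionIso W G hT) hρ hadd ht3 htℓ hunitW hunitG htam htamG hordG Gd D D'
    K hK hH hH' hKoW hKoG hGZG hd hGd H H' ι 𝔭 h𝔭 he hf P P' hP hP' hPinf hP'inf Wt hWt htorst hSelW
    hSelWt hQW hcD hc3'

/-- **O5 (t′) `htamGd'`-free END (`…_cited_s0f`) in X3E-CERTIFICATE CURRENCY (direct kind)**: `hcong`
REPLACED by ONE ROW `(l, m, u)` of the cell's X3E table — `u ≠ 0`, `𝔠₄(l,m) = u⁴·c₄(G)`,
`𝔠₆(l,m) = u⁶·c₆(G)` (two `norm_num` identities against `Fisher2012.eval_hesseC4three /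
eval_hesseC6three`; part 20 `isCongruentModThree_of_hesseCertificate`) — the companion relation then
rests on NO named fact (Fisher 2012 Thm. 13.2, `n = 3`, proved in the tree). Every other binder of
`…_cited_s0f` verbatim; no Tamagawa datum of the twist `G_d`.
[cite: KrizLi2019, Thm. 1.16, Rem. 1.17 (FMS 7 (2019) e15)] [cite: Fisher2012Hessian, Thm. 13.2 (n = 3)] -/
theorem o5_index_unit_of_ordinary_companion_cited_s0f_x3e
    (hKL : KrizLi2019.thm116_padicLogHeegner_congruence)
    (hPT : ∀ (K : Type) [Field K] [NumberField K], poitouTate_selmerStructure_duality K)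
    (hEP : ∀ (K : Type) [Field K] [NumberField K] (v : HeightOneSpectrum (𝓞 K)),
      localEulerPoincareCharacteristic (v.adicCompletion K))
    (hYZ : YanZhu2026.thm415_padicValRat_bsd_rank_le_one)
    (hW20 : Wuthrich2014.lemma20_surjective_threeAdic_of_semistable)
    (hmod : exists_isNewformOf) (hGZK : rank_eq_analyticRank_of_analyticRank_le_one)
    (W G : WeierstrassCurve ℚ) [W.IsElliptic] [W.IsGloballyMinimal] [G.IsElliptic] [G.IsGloballyMinimal]
    (l m u : ℚ) (hu : u ≠ 0)
    (h4 : MvPolynomial.eval ![l, m] (hesseC4three W.c₄ W.c₆) = u ^ 4 * G.c₄)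
    (h6 : MvPolynomial.eval ![l, m] (hesseC6three W.c₄ W.c₆) = u ^ 6 * G.c₆)
    (hρ : W.HasSurjectiveModNGaloisRep 3) (hadd : Addv W 3) (ht3 : NoLocalThreeTorsionAt W 3)
    (htℓ : ∀ (ℓ : ℕ) [Fact ℓ.Prime], ℓ ≠ 3 → (ℓ : ℤ) ∣ W.conductorNorm ℤ * G.conductorNorm ℤ →
      NoLocalThreeTorsionAt W ℓ)
    (hunitW : ∀ ℓ ∈ klSet W G, ℓ ≠ 3 → padicValInt 3 (nsCount W ℓ) = 0)
    (hunitG : ∀ ℓ ∈ klSet G W, ℓ ≠ 3 → padicValInt 3 (nsCount G ℓ) = 0)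
    (htam : ¬ 3 ∣ W.tamagawaProduct) (htamG : ¬ 3 ∣ G.tamagawaProduct) (hordG : GoodOrd G 3)
    (Gd : WeierstrassCurve ℚ) [Gd.IsElliptic] [Gd.IsGloballyMinimal]
    {N N' : ℕ} [NeZero N] [NeZero N'] (D : ModularParametrizationData W N)
    (D' : ModularParametrizationData G N')
    (K : Type) [Field K] [NumberField K] (hK : IsImaginaryQuadratic K)
    (hH : SatisfiesHeegnerHypothesis N K) (hH' : SatisfiesHeegnerHypothesis N' K)
    (hKoW : kolyvagin N W K) (hKoG : kolyvagin N' G K) (hGZG : gross_zagier N' G K)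
    (hd : NumberField.discr K < -4)
    (hGd : ∃ C : VariableChange ℚ, C • G.quadraticTwist (NumberField.discr K : ℚ) = Gd)
    (H : HeegnerDatum N (NumberField.discr K)) (H' : HeegnerDatum N' (NumberField.discr K))
    (ι : K →+* ℂ) (𝔭 : HeightOneSpectrum (𝓞 K)) (h𝔭 : ((3 : ℕ) : 𝓞 K) ∈ 𝔭.asIdeal)
    (he : 𝔭.asIdeal.ramificationIdx (𝓞 ℚ) = 1) (hf : 𝔭.asIdeal.inertiaDeg (𝓞 ℚ) = 1)
    (P : (W.baseChange K).toAffine.Point) (P' : (G.baseChange K).toAffine.Point)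
    (hP : WeierstrassCurve.Affine.Point.map ι.toRatAlgHom P = heegnerPointComplex D H)
    (hP' : WeierstrassCurve.Affine.Point.map ι.toRatAlgHom P' = heegnerPointComplex D' H')
    (hPinf : ¬ IsOfFinAddOrder P) (hP'inf : ¬ IsOfFinAddOrder P')
    (Wt : WeierstrassCurve ℚ) [Wt.IsElliptic]
    (hWt : ∃ C : VariableChange ℚ, C • W.quadraticTwist (NumberField.discr K : ℚ) = Wt)
    (htorst : ¬ 3 ∣ Wt.torsionOrder)
    (hSelW : Nat.card (W.selmerGroup (3 : ℤ)) = 3 ^ W.mordellWeilRank)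
    (hSelWt : Nat.card (Wt.selmerGroup (3 : ℤ)) = 3 ^ Wt.mordellWeilRank)
    (hQW : ∃ Q : (W.baseChange K).toAffine.Point, ¬ IsOfFinAddOrder Q ∧
      X11b.padicLogOrd W 3 (embAt K 3 𝔭 h𝔭 he hf) Q = 0)
    (hcD : padicValInt 3 D.maninConstant = 0) (hc3' : ¬ ((3 : ℤ) ∣ D'.maninConstant)) :
    padicValNat 3 (AddSubgroup.zmultiples P).index = 0 :=
  o5_index_unit_of_ordinary_companion_cited_s0f hKL hPT hEP hYZ hW20 hmod hGZK W G
    (isCongruentModThree_of_hesseCertificate W G l m u hu h4 h6) hρ hadd ht3 htℓ hunitW hunitG htam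
    htamG hordG Gd D D' K hK hH hH' hKoW hKoG hGZG hd hGd H H' ι 𝔭 h𝔭 he hf P P' hP hP' hPinf hP'inf
    Wt hWt htorst hSelW hSelWt hQW hcD hc3'

/-- **O5 (t′) `htamGd'`-free END (`…_cited_s0f`) in X3E-CERTIFICATE CURRENCY (reverse kind)**: `hcong`
REPLACED by one row of the dual family (`Δ′ = c₄(W)³ − c₆(W)²`: `−𝔇(l,m)/(4Δ′) = u⁴·c₄(G)`,
`−𝔠₆(l,m)/(8Δ′²) = u⁶·c₆(G)`; the anti-symplectic `3`-congruences; the `X_E^-(3)` analogue of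
Thm. 13.2, proved in the tree; part 20 `isCongruentModThree_of_dualHesseCertificate`). Every other
binder of `…_cited_s0f` verbatim; no Tamagawa datum of the twist `G_d`.
[cite: KrizLi2019, Thm. 1.16, Rem. 1.17 (FMS 7 (2019) e15)]
[cite: Fisher2012Hessian, §13 (analogue of Thm. 13.2 for X_E^-(3))] -/
theorem o5_index_unit_of_ordinary_companion_cited_s0f_x3eRev
    (hKL : KrizLi2019.thm116_padicLogHeegner_congruence)
    (hPT : ∀ (K : Type) [Field K] [NumberField K], poitouTate_selmerStructure_duality K)
    (hEP : ∀ (K : Type) [Field K] [NumberField K] (v : HeightOneSpectrum (𝓞 K)),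
      localEulerPoincareCharacteristic (v.adicCompletion K))
    (hYZ : YanZhu2026.thm415_padicValRat_bsd_rank_le_one)
    (hW20 : Wuthrich2014.lemma20_surjective_threeAdic_of_semistable)
    (hmod : exists_isNewformOf) (hGZK : rank_eq_analyticRank_of_analyticRank_le_one)
    (W G : WeierstrassCurve ℚ) [W.IsElliptic] [W.IsGloballyMinimal] [G.IsElliptic] [G.IsGloballyMinimal]
    (l m u : ℚ) (hu : u ≠ 0)
    (h4 : -MvPolynomial.eval ![l, m] (hesseD3 W.c₄ W.c₆) / (4 * (W.c₄ ^ 3 - W.c₆ ^ 2)) = u ^ 4 * G.c₄)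
    (h6 : -MvPolynomial.eval ![l, m] (hesseC6three W.c₄ W.c₆) / (8 * (W.c₄ ^ 3 - W.c₆ ^ 2) ^ 2) =
      u ^ 6 * G.c₆)
    (hρ : W.HasSurjectiveModNGaloisRep 3) (hadd : Addv W 3) (ht3 : NoLocalThreeTorsionAt W 3)
    (htℓ : ∀ (ℓ : ℕ) [Fact ℓ.Prime], ℓ ≠ 3 → (ℓ : ℤ) ∣ W.conductorNorm ℤ * G.conductorNorm ℤ →
      NoLocalThreeTorsionAt W ℓ)
    (hunitW : ∀ ℓ ∈ klSet W G, ℓ ≠ 3 → padicValInt 3 (nsCount W ℓ) = 0)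
    (hunitG : ∀ ℓ ∈ klSet G W, ℓ ≠ 3 → padicValInt 3 (nsCount G ℓ) = 0)
    (htam : ¬ 3 ∣ W.tamagawaProduct) (htamG : ¬ 3 ∣ G.tamagawaProduct) (hordG : GoodOrd G 3)
    (Gd : WeierstrassCurve ℚ) [Gd.IsElliptic] [Gd.IsGloballyMinimal]
    {N N' : ℕ} [NeZero N] [NeZero N'] (D : ModularParametrizationData W N)
    (D' : ModularParametrizationData G N')
    (K : Type) [Field K] [NumberField K] (hK : IsImaginaryQuadratic K)
    (hH : SatisfiesHeegnerHypothesis N K) (hH' : SatisfiesHeegnerHypothesis N' K)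
    (hKoW : kolyvagin N W K) (hKoG : kolyvagin N' G K) (hGZG : gross_zagier N' G K)
    (hd : NumberField.discr K < -4)
    (hGd : ∃ C : VariableChange ℚ, C • G.quadraticTwist (NumberField.discr K : ℚ) = Gd)
    (H : HeegnerDatum N (NumberField.discr K)) (H' : HeegnerDatum N' (NumberField.discr K))
    (ι : K →+* ℂ) (𝔭 : HeightOneSpectrum (𝓞 K)) (h𝔭 : ((3 : ℕ) : 𝓞 K) ∈ 𝔭.asIdeal)
    (he : 𝔭.asIdeal.ramificationIdx (𝓞 ℚ) = 1) (hf : 𝔭.asIdeal.inertiaDeg (𝓞 ℚ) = 1)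
    (P : (W.baseChange K).toAffine.Point) (P' : (G.baseChange K).toAffine.Point)
    (hP : WeierstrassCurve.Affine.Point.map ι.toRatAlgHom P = heegnerPointComplex D H)
    (hP' : WeierstrassCurve.Affine.Point.map ι.toRatAlgHom P' = heegnerPointComplex D' H')
    (hPinf : ¬ IsOfFinAddOrder P) (hP'inf : ¬ IsOfFinAddOrder P')
    (Wt : WeierstrassCurve ℚ) [Wt.IsElliptic]
    (hWt : ∃ C : VariableChange ℚ, C • W.quadraticTwist (NumberField.discr K : ℚ) = Wt)
    (htorst : ¬ 3 ∣ Wt.torsionOrder)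
    (hSelW : Nat.card (W.selmerGroup (3 : ℤ)) = 3 ^ W.mordellWeilRank)
    (hSelWt : Nat.card (Wt.selmerGroup (3 : ℤ)) = 3 ^ Wt.mordellWeilRank)
    (hQW : ∃ Q : (W.baseChange K).toAffine.Point, ¬ IsOfFinAddOrder Q ∧
      X11b.padicLogOrd W 3 (embAt K 3 𝔭 h𝔭 he hf) Q = 0)
    (hcD : padicValInt 3 D.maninConstant = 0) (hc3' : ¬ ((3 : ℤ) ∣ D'.maninConstant)) :
    padicValNat 3 (AddSubgroup.zmultiples P).index = 0 :=
  o5_index_unit_of_ordinary_companion_cited_s0f hKL hPT hEP hYZ hW20 hmod hGZK W G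
    (isCongruentModThree_of_dualHesseCertificate W G l m u hu h4 h6) hρ hadd ht3 htℓ hunitW hunitG htam
    htamG hordG Gd D D' K hK hH hH' hKoW hKoG hGZG hd hGd H H' ι 𝔭 h𝔭 he hf P P' hP hP' hPinf hP'inf
    Wt hWt htorst hSelW hSelWt hQW hcD hc3'

end Summit.BirchSwinnertonDyer.Rank1Residual.O5.HeegnerLogTransport

end
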